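import Mathlib
import Literature.Analysis.FluidPDE.LoopCirculation
import Summits.NavierStokesRegularity.NavierStokesRegularity.Theorems.TautLoopKelvinTautLoopLawStepImageLengthTools
import HarnessLib

/-!
# Route `TautLoopKelvin`, crux `TautLoopLaw` (stmt-NavierStokesRegularity-15249), line
  `Sketch-ideas-r1k1` (Dini–Saks architecture) — tools stub `stub_tautLoopWalk6AAux`

Pure auxiliary lemmas for the assembly of the random-walk Kelvin selection (skeleton stub 6A
`stub_tautLoopWalkSelection`), part 1:

* extraction of a threshold `h₀` from an eventual property at `0⁺`, and the eventual smallness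
  facts used as thresholds (affine quantities `a h + b h^{1/3} → 0`, and the super-polynomial
  tail `C e^{-1/(c h^{1/3})} ≤ h^{m/3}`, from `x^m e^{-x} → 0`);
* circulations of two continuous fields differing by a gradient plus a uniformly small remainder
  differ by at most `ε · len γ` around a closed `C¹` loop (the exact part integrates to zero);
* displacement of the recursively deformed points `z_k = A_k z_{k+1} + y_k` against the partial
  sums of the translations;
* the length of the image of a loop under a `C¹` map with bounded differential, the final
  exponential length algebra, the `o(h)` bookkeeping, the tail arithmetic and the first-moment
  selection over the bulk paths ("a mean is at most a max").

Everything is folklore real analysis / finite combinatorics, proved from Mathlib and the sibling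
tools files of the line.
-/

noncomputable section

open Set Function Filter Topology MeasureTheory intervalIntegral Literature.Analysis.FluidPDE
open scoped InnerProductSpace RealInnerProductSpace

namespace Summit.NavierStokesRegularity.NavierStokesRegularity.Theorems

set_option linter.dupNamespace false

local notation3 "E3" => EuclideanSpace ℝ (Fin 3)

/-! ## Thresholds -/

/-- Extraction of a threshold `h₀ > 0` from a property holding eventually at `0⁺`. [folklore] -/
theorem tautLoopWalk6A_exists_h0 (P : ℝ → Prop)
    (hP : ∀ᶠ h in nhdsWithin (0:ℝ) (Set.Ioi 0), P h) :
    ∃ h₀ : ℝ, 0 < h₀ ∧ ∀ h : ℝ, 0 < h → h < h₀ → P h := by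
  obtain ⟨u, hu, hsub⟩ := mem_nhdsGT_iff_exists_Ioo_subset.1 hP
  exact ⟨u, hu, fun h hh hhu => hsub ⟨hh, hhu⟩⟩

/-- Eventually at `0⁺`, `h < c` for any `c > 0`. [folklore] -/
theorem tautLoopWalk6A_eventually_lt (c : ℝ) (hc : 0 < c) :
    ∀ᶠ h in nhdsWithin (0:ℝ) (Set.Ioi 0), h < c :=
  (tendsto_nhdsWithin_of_tendsto_nhds tendsto_id).eventually_lt_const hc

/-- Eventually at `0⁺`, the affine quantity `a h + b h^{1/3}` is at most `c`, for any `c > 0`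
(continuity at `0`). [folklore] -/
theorem tautLoopWalk6A_eventually_affine (a b c : ℝ) (hc : 0 < c) :
    ∀ᶠ h in nhdsWithin (0:ℝ) (Set.Ioi 0), a * h + b * h ^ (1 / 3 : ℝ) ≤ c := by
  have hcont : Continuous fun h : ℝ => a * h + b * h ^ (1 / 3 : ℝ) :=
    (continuous_const.mul continuous_id).add
      (continuous_const.mul (Real.continuous_rpow_const (by norm_num)))
  have ht := hcont.tendsto' 0 0 (by simp)
  exact (tendsto_nhdsWithin_of_tendsto_nhds ht).eventually_le_const hc

/-- The cube root tends to `0⁺` at `0⁺`. [folklore] -/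
theorem tautLoopWalk6A_tendsto_cuberoot :
    Tendsto (fun h : ℝ => h ^ (1 / 3 : ℝ)) (nhdsWithin (0:ℝ) (Set.Ioi 0))
      (nhdsWithin (0:ℝ) (Set.Ioi 0)) := by
  refine tendsto_nhdsWithin_iff.2 ⟨?_, ?_⟩
  · have ht := (Real.continuous_rpow_const (by norm_num : (0:ℝ) ≤ 1 / 3)).tendsto 0
    rw [Real.zero_rpow (by norm_num : (1 / 3 : ℝ) ≠ 0)] at ht
    exact tendsto_nhdsWithin_of_tendsto_nhds ht
  · filter_upwards [eventually_mem_nhdsWithin] with h hh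
    exact Real.rpow_pos_of_pos hh _

/-- **Super-polynomial tail threshold**: for `c > 0`, eventually at `0⁺`,
`C e^{-1/(c h^{1/3})} ≤ (h^{1/3})^m` (since `x^m e^{-x/c} → 0` at `+∞`). [folklore] -/
theorem tautLoopWalk6A_eventually_tail (c C : ℝ) (m : ℕ) (hc : 0 < c) :
    ∀ᶠ h in nhdsWithin (0:ℝ) (Set.Ioi 0),
      C * Real.exp (-(1 / (c * h ^ (1 / 3 : ℝ)))) ≤ (h ^ (1 / 3 : ℝ)) ^ m := by
  -- at `+∞`: `C x^m e^{-x/c} ≤ 1`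
  have h1 : Tendsto (fun x : ℝ => (x / c) ^ m * Real.exp (-(x / c))) atTop (𝓝 0) :=
    (Real.tendsto_pow_mul_exp_neg_atTop_nhds_zero m).comp (tendsto_id.atTop_div_const hc)
  have h2 : Tendsto (fun x : ℝ => C * c ^ m * ((x / c) ^ m * Real.exp (-(x / c)))) atTop
      (𝓝 0) := by
    simpa using h1.const_mul (C * c ^ m)
  have h3 : ∀ᶠ x : ℝ in atTop, C * x ^ m * Real.exp (-(x / c)) ≤ 1 := by
    filter_upwards [h2.eventually_le_const one_pos] with x hx
    have e : C * c ^ m * ((x / c) ^ m * Real.exp (-(x / c))) = C * x ^ m * Real.exp (-(x / c)) := by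
      rw [div_pow]
      field_simp
    rwa [e] at hx
  -- at `0⁺` in the variable `λ = x⁻¹`
  have h4 : ∀ᶠ lam : ℝ in nhdsWithin (0:ℝ) (Set.Ioi 0),
      C * Real.exp (-(1 / (c * lam))) ≤ lam ^ m := by
    filter_upwards [tendsto_inv_nhdsGT_zero.eventually h3, eventually_mem_nhdsWithin]
      with lam hlam hpos
    have hpos' : (0:ℝ) < lam := hpos
    have e1 : lam⁻¹ / c = 1 / (c * lam) := by field_simp
    rw [e1, inv_pow] at hlam
    have hxm : 0 < (lam ^ m)⁻¹ := by positivity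
    calc C * Real.exp (-(1 / (c * lam)))
        = (C * (lam ^ m)⁻¹ * Real.exp (-(1 / (c * lam)))) * lam ^ m := by
          field_simp
      _ ≤ 1 * lam ^ m := by gcongr
      _ = lam ^ m := one_mul _
  exact tautLoopWalk6A_tendsto_cuberoot.eventually h4

/-! ## Circulations modulo gradients -/

/-- If two continuous fields differ by a gradient of a differentiable potential up to a remainder
of sup norm `≤ ε`, their circulations around a closed `C¹` loop differ by at most `ε · len γ`:
the exact part `⟪∇Q(γ), γ′⟫ = (Q ∘ γ)′` is measurable, dominated, and integrates to
`Q(γ 1) − Q(γ 0) = 0`. [folklore] -/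
theorem tautLoopWalk6A_circulation_sub_le (f g : E3 → E3) (Q : E3 → ℝ) (γ : ℝ → E3) (ε : ℝ)
    (hf : Continuous f) (hg : Continuous g) (hQ : Differentiable ℝ Q) (hγ : IsC1Loop γ)
    (hε : ∀ x, ‖f x - g x - gradient Q x‖ ≤ ε) :
    |circulation f γ - circulation g γ| ≤ ε * ∫ σ in (0:ℝ)..1, ‖deriv γ σ‖ := by
  rw [← circulation_sub_left hf hg hγ.contDiff]
  have hder : ∀ σ, HasDerivAt (fun s => Q (γ s)) ⟪gradient Q (γ σ), deriv γ σ⟫ σ := fun σ => by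
    have h := (hQ (γ σ)).hasFDerivAt.comp_hasDerivAt σ (hγ.differentiable σ).hasDerivAt
    rwa [← inner_gradient_left] at h
  have hφeq : (fun σ => ⟪gradient Q (γ σ), deriv γ σ⟫) = deriv (fun s => Q (γ s)) :=
    funext fun σ => (hder σ).deriv.symm
  have hψc : Continuous fun σ => ⟪(f - g) (γ σ), deriv γ σ⟫ :=
    ((hf.sub hg).comp hγ.continuous).inner hγ.continuous_deriv
  have hγ'c : Continuous fun σ => ‖deriv γ σ‖ := hγ.continuous_deriv.norm
  have hpt : ∀ σ, ‖⟪(f - g) (γ σ), deriv γ σ⟫ - ⟪gradient Q (γ σ), deriv γ σ⟫‖ ≤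
      ε * ‖deriv γ σ‖ := by
    intro σ
    rw [← inner_sub_left, Real.norm_eq_abs]
    refine (abs_real_inner_le_norm _ _).trans ?_
    exact mul_le_mul_of_nonneg_right (by simpa using hε (γ σ)) (norm_nonneg _)
  have hφi : IntervalIntegrable (fun σ => ⟪gradient Q (γ σ), deriv γ σ⟫) volume 0 1 := by
    refine ((hψc.norm.add ((continuous_const (y := ε)).mul hγ'c)).intervalIntegrable 0
      1).mono_fun' ?_ ?_
    · rw [hφeq]
      exact (measurable_deriv _).aestronglyMeasurable
    · refine Filter.Eventually.of_forall fun σ => ?_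
      calc ‖⟪gradient Q (γ σ), deriv γ σ⟫‖
          = ‖⟪(f - g) (γ σ), deriv γ σ⟫ -
              (⟪(f - g) (γ σ), deriv γ σ⟫ - ⟪gradient Q (γ σ), deriv γ σ⟫)‖ := by
            rw [sub_sub_cancel]
        _ ≤ ‖⟪(f - g) (γ σ), deriv γ σ⟫‖ +
              ‖⟪(f - g) (γ σ), deriv γ σ⟫ - ⟪gradient Q (γ σ), deriv γ σ⟫‖ := norm_sub_le _ _
        _ ≤ ‖⟪(f - g) (γ σ), deriv γ σ⟫‖ + ε * ‖deriv γ σ‖ := add_le_add le_rfl (hpt σ)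
  have hFTC : (∫ σ in (0:ℝ)..1, ⟪gradient Q (γ σ), deriv γ σ⟫) = 0 := by
    rw [integral_eq_sub_of_hasDerivAt (fun σ _ => hder σ) hφi, hγ.apply_zero_eq_apply_one,
      sub_self]
  have hψi : IntervalIntegrable (fun σ => ⟪(f - g) (γ σ), deriv γ σ⟫) volume 0 1 :=
    hψc.intervalIntegrable 0 1
  unfold circulation
  have e : (∫ σ in (0:ℝ)..1, ⟪(f - g) (γ σ), deriv γ σ⟫) =
      ∫ σ in (0:ℝ)..1, (⟪(f - g) (γ σ), deriv γ σ⟫ - ⟪gradient Q (γ σ), deriv γ σ⟫) := by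
    rw [integral_sub hψi hφi, hFTC, sub_zero]
  rw [e, ← Real.norm_eq_abs, ← intervalIntegral.integral_const_mul]
  exact norm_integral_le_of_norm_le zero_le_one (Filter.Eventually.of_forall fun σ _ => hpt σ)
    (((continuous_const (y := ε)).mul hγ'c).intervalIntegrable 0 1)

/-! ## Displacements along the deformed orbit -/

/-- **Displacement against the partial sums of the translations.** If `‖A_k y − y‖ ≤ D`,
`S_0 = 0`, `S_{k+1} = S_k + y_k`, `z_n = x` and `z_k = A_k z_{k+1} + y_k`, then
`‖z_k − x − (S_n − S_k)‖ ≤ (n − k) D` for `k ≤ n`. [folklore] -/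
theorem tautLoopWalk6A_disp_partial (n : ℕ) (A Ψ : ℕ → E3 → E3) (yv S : ℕ → E3) (D : ℝ)
    (x : E3) (hA : ∀ k, k < n → ∀ y, ‖A k y - y‖ ≤ D) (hS0 : S 0 = 0)
    (hS : ∀ k, k < n → S (k + 1) = S k + yv k) (hΨn : Ψ n x = x)
    (hΨ : ∀ k, k < n → Ψ k x = A k (Ψ (k + 1) x) + yv k) :
    ∀ k, k ≤ n → ‖Ψ k x - x - (S n - S k)‖ ≤ (n - k) * D := by
  have key : ∀ m k : ℕ, k + m = n → ‖Ψ k x - x - (S n - S k)‖ ≤ m * D := by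
    intro m
    induction m with
    | zero =>
      intro k hk
      obtain rfl : k = n := by simpa using hk
      simp [hΨn]
    | succ m ih =>
      intro k hk
      have hkn : k < n := by omega
      have h1 := ih (k + 1) (by omega)
      have e : Ψ k x - x - (S n - S k) = (A k (Ψ (k + 1) x) - Ψ (k + 1) x) +
          (Ψ (k + 1) x - x - (S n - S (k + 1))) := by
        rw [hΨ k hkn, hS k hkn]
        abel
      rw [e]
      calc _ ≤ ‖A k (Ψ (k + 1) x) - Ψ (k + 1) x‖ + ‖Ψ (k + 1) x - x - (S n - S (k + 1))‖ :=
            norm_add_le _ _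
        _ ≤ D + m * D := add_le_add (hA k hkn _) h1
        _ = ((m + 1 : ℕ) : ℝ) * D := by push_cast; ring
  intro k hk
  have h := key (n - k) k (by omega)
  have hS00 := hS0
  rwa [Nat.cast_sub hk] at h

/-! ## Lengths -/

/-- Length of the image of a closed `C¹` loop under a `C¹` map with `‖DΨ‖ ≤ C`:
`len (Ψ ∘ γ) ≤ C · len γ`. [folklore] -/
theorem tautLoopWalk6A_len_comp_le (Ψ : E3 → E3) (γ : ℝ → E3) (C : ℝ) (hΨ : ContDiff ℝ 1 Ψ)
    (hγ : IsC1Loop γ) (hC : ∀ x, ‖fderiv ℝ Ψ x‖ ≤ C) :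
    (∫ σ in (0:ℝ)..1, ‖deriv (Ψ ∘ γ) σ‖) ≤ C * ∫ σ in (0:ℝ)..1, ‖deriv γ σ‖ := by
  rw [← intervalIntegral.integral_const_mul]
  refine intervalIntegral.integral_mono_on zero_le_one ?_ ?_ fun σ _ => ?_
  · exact ((hΨ.comp hγ.contDiff).continuous_deriv le_rfl).norm.intervalIntegrable 0 1
  · exact (continuous_const.mul hγ.continuous_deriv.norm).intervalIntegrable 0 1
  · rw [tautLoopImgLen_deriv_comp hΨ hγ σ]
    exact (fderiv ℝ Ψ (γ σ)).le_of_opNorm_le (hC _) _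

/-- **Exponential length algebra**: from `len' ≤ ℓ + h N + (ε + h²β²) ℓ`, `|N| ≤ β ℓ` and
`ε + h²β² ≤ h δ` deduce `len' ≤ ℓ · exp(h (N/ℓ + δ))` (junk `N/0 = 0` included: then `N = 0`).
[folklore] -/
theorem tautLoopWalk6A_len_algebra (ℓ ℓ' N h ε β δ : ℝ) (hℓ : 0 ≤ ℓ) (hN : |N| ≤ β * ℓ)
    (hlen : ℓ' ≤ ℓ + h * N + (ε + h ^ 2 * β ^ 2) * ℓ) (hsmall : ε + h ^ 2 * β ^ 2 ≤ h * δ) :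
    ℓ' ≤ ℓ * Real.exp (h * (N / ℓ + δ)) := by
  rcases hℓ.eq_or_lt with hℓ0 | hℓpos
  · have hN0 : N = 0 := by
      rw [← hℓ0, mul_zero] at hN
      exact abs_nonpos_iff.1 hN
    rw [← hℓ0] at hlen ⊢
    simp only [hN0, mul_zero, add_zero, zero_mul] at hlen ⊢
    exact hlen
  · have e1 : h * N = ℓ * (h * (N / ℓ)) := by field_simp
    have h2 : ℓ' ≤ ℓ * (h * (N / ℓ + δ) + 1) := by
      calc ℓ' ≤ ℓ + h * N + (ε + h ^ 2 * β ^ 2) * ℓ := hlen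
        _ ≤ ℓ + h * N + (h * δ) * ℓ := by gcongr
        _ = ℓ * (h * (N / ℓ + δ) + 1) := by rw [e1]; ring
    exact h2.trans (mul_le_mul_of_nonneg_left (Real.add_one_le_exp _) hℓ)

/-- **The `o(h)` bookkeeping of the bulk derivative error**: with `nτ = h ≤ 1`, `τ ≤ h`,
`e^{n(τB₁+Kτ²)}((n(τB₁+Kτ²))² + nKτ²) + nτ(B₂(nKτ + 2λ) + Bt h) + h²B₁² ≤ h δ` as soon as
`(e^{B₁+K}((B₁+K)² + K) + B₂K + Bt + B₁²) h + 2B₂ λ ≤ δ`. [folklore] -/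
theorem tautLoopWalk6A_eps_arith (n : ℕ) (τ h K B₁ B₂ Bt lam δ : ℝ) (hnτ : (n : ℝ) * τ = h)
    (hh0 : 0 ≤ h) (hh1 : h ≤ 1) (hτ0 : 0 ≤ τ) (hτh : τ ≤ h) (hK : 0 ≤ K) (hB₁ : 0 ≤ B₁)
    (he : (Real.exp (B₁ + K) * ((B₁ + K) ^ 2 + K) + B₂ * K + Bt + B₁ ^ 2) * h +
      2 * B₂ * lam ≤ δ) :
    Real.exp (n * (τ * B₁ + K * τ ^ 2)) * ((n * (τ * B₁ + K * τ ^ 2)) ^ 2 + n * (K * τ ^ 2)) +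
      n * τ * (B₂ * (n * (K * τ) + 2 * lam) + Bt * h) + h ^ 2 * B₁ ^ 2 ≤ h * δ := by
  have hα : (n : ℝ) * (τ * B₁ + K * τ ^ 2) = h * B₁ + K * h * τ := by
    rw [← hnτ]; ring
  have hnK : (n : ℝ) * (K * τ ^ 2) = K * h * τ := by rw [← hnτ]; ring
  have hnKτ : (n : ℝ) * (K * τ) = K * h := by rw [← hnτ]; ring
  rw [hα, hnK, hnKτ, hnτ]
  have hτ1 : τ ≤ 1 := hτh.trans hh1
  have hα1 : h * B₁ + K * h * τ ≤ B₁ + K := by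
    have : h * B₁ ≤ 1 * B₁ := by gcongr
    have : K * h * τ ≤ K * 1 * 1 := by gcongr
    linarith
  have hexp : Real.exp (h * B₁ + K * h * τ) ≤ Real.exp (B₁ + K) := Real.exp_le_exp.2 hα1
  have hα0 : 0 ≤ h * B₁ + K * h * τ := by positivity
  have hsq : (h * B₁ + K * h * τ) ^ 2 ≤ h ^ 2 * (B₁ + K) ^ 2 := by
    have h1 : h * B₁ + K * h * τ ≤ h * (B₁ + K) := by
      nlinarith [mul_le_mul_of_nonneg_left hτ1 (mul_nonneg hK hh0)]
    calc (h * B₁ + K * h * τ) ^ 2 ≤ (h * (B₁ + K)) ^ 2 := pow_le_pow_left₀ hα0 h1 2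
      _ = h ^ 2 * (B₁ + K) ^ 2 := by ring
  have hKhτ : K * h * τ ≤ h ^ 2 * K := by
    nlinarith [mul_le_mul_of_nonneg_left hτh (mul_nonneg hK hh0)]
  have hterm1 : Real.exp (h * B₁ + K * h * τ) * ((h * B₁ + K * h * τ) ^ 2 + K * h * τ) ≤
      Real.exp (B₁ + K) * ((B₁ + K) ^ 2 + K) * h ^ 2 := by
    calc Real.exp (h * B₁ + K * h * τ) * ((h * B₁ + K * h * τ) ^ 2 + K * h * τ)
        ≤ Real.exp (B₁ + K) * (h ^ 2 * (B₁ + K) ^ 2 + h ^ 2 * K) := by gcongr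
      _ = Real.exp (B₁ + K) * ((B₁ + K) ^ 2 + K) * h ^ 2 := by ring
  have hh2 : h ^ 2 ≤ h := by nlinarith
  have hC0 : 0 ≤ Real.exp (B₁ + K) * ((B₁ + K) ^ 2 + K) := by positivity
  nlinarith [mul_le_mul_of_nonneg_left he hh0, mul_le_mul_of_nonneg_left hh2 hC0, sq_nonneg B₁]

/-! ## Counting and selection -/

/-- **Tail arithmetic**: with `λ³ = h`, `a² = 6ν h/n`, a count `cnt ≤ 12 · 6ⁿ e^{-λ²/(6na²)}`
and the thresholds `24 Kᵤ e^{-1/(36νλ)} ≤ λ^{3M}`, `13 e^{-1/(36νλ)} ≤ 1`, one has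
`cnt · Kᵤ ≤ 6ⁿ h^M / 2` and `cnt < 6ⁿ`. [folklore] -/
theorem tautLoopWalk6A_tail_arith (ν h lam a Ku cnt : ℝ) (n M : ℕ) (hν : 0 < ν)
    (hn : 0 < n) (hlam : 0 < lam) (hlam3 : lam ^ 3 = h) (ha2 : a ^ 2 = 6 * ν * (h / n))
    (hKu : 0 ≤ Ku) (hcnt : cnt ≤ 12 * (6:ℝ) ^ n * Real.exp (-(lam ^ 2) / (6 * n * a ^ 2)))
    (hT1 : 24 * Ku * Real.exp (-(1 / (36 * ν * lam))) ≤ lam ^ (3 * M))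
    (hT2 : 13 * Real.exp (-(1 / (36 * ν * lam))) ≤ lam ^ 0) :
    cnt * Ku ≤ (6:ℝ) ^ n * (h ^ M / 2) ∧ cnt < (6:ℝ) ^ n := by
  have hn' : (0:ℝ) < n := Nat.cast_pos.2 hn
  have hh : 0 < h := by rw [← hlam3]; positivity
  have hexp : Real.exp (-(lam ^ 2) / (6 * n * a ^ 2)) = Real.exp (-(1 / (36 * ν * lam))) := by
    congr 1
    rw [ha2, ← hlam3]
    field_simp
    ring
  rw [hexp] at hcnt
  set E := Real.exp (-(1 / (36 * ν * lam))) with hE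
  have hE0 : 0 < E := Real.exp_pos _
  have h6 : (0:ℝ) < (6:ℝ) ^ n := by positivity
  have hpow : lam ^ (3 * M) = h ^ M := by rw [pow_mul, hlam3]
  rw [hpow] at hT1
  rw [pow_zero] at hT2
  constructor
  · calc cnt * Ku ≤ 12 * (6:ℝ) ^ n * E * Ku := mul_le_mul_of_nonneg_right hcnt hKu
      _ = (6:ℝ) ^ n * ((24 * Ku * E) / 2) := by ring
      _ ≤ (6:ℝ) ^ n * (h ^ M / 2) := by gcongr
  · calc cnt ≤ 12 * (6:ℝ) ^ n * E := hcnt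
      _ < 13 * (6:ℝ) ^ n * E := by gcongr; norm_num
      _ = (6:ℝ) ^ n * (13 * E) := by ring
      _ ≤ (6:ℝ) ^ n * 1 := by gcongr
      _ = (6:ℝ) ^ n := mul_one _

/-- **First-moment selection over the bulk ("a mean is at most a max").** If the average of
`F` over all `N` paths is within `e/2` of `Γ`, `|F| ≤ Kᵤ` everywhere, the bad paths carry at
most `#Bad · Kᵤ ≤ N e/2` and `#Bad < N`, then some good path has `Γ − e ≤ |F p|`. [folklore] -/
theorem tautLoopWalk6A_select {ι : Type*} [Fintype ι] [DecidableEq ι] (Bad : Finset ι)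
    (F : ι → ℝ) (Γ Ku e N : ℝ) (hN : (Fintype.card ι : ℝ) = N) (hNpos : 0 < N)
    (havg : |N⁻¹ * (∑ p, F p) - Γ| ≤ e / 2) (hF : ∀ p, |F p| ≤ Ku)
    (htail : (Bad.card : ℝ) * Ku ≤ N * (e / 2)) (hlt : (Bad.card : ℝ) < N) :
    ∃ p, p ∉ Bad ∧ Γ - e ≤ |F p| := by
  have hne : (Badᶜ).Nonempty := by
    rw [← Finset.card_pos, Finset.card_compl]
    have h1 : Bad.card < Fintype.card ι := by exact_mod_cast (hN ▸ hlt : (Bad.card : ℝ) < _)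
    omega
  rcases lt_or_ge (Γ - e) 0 with hneg | hpos
  · obtain ⟨p, hp⟩ := hne
    exact ⟨p, (Finset.mem_compl.1 hp), hneg.le.trans (abs_nonneg _)⟩
  · -- the sum over the good paths is at least `N (Γ - e)`
    have hall : N * (Γ - e / 2) ≤ ∑ p, F p := by
      have h1 : Γ - e / 2 ≤ N⁻¹ * ∑ p, F p := by linarith [(abs_le.1 havg).1]
      have h2 := mul_le_mul_of_nonneg_left h1 hNpos.le
      rwa [← mul_assoc, mul_inv_cancel₀ hNpos.ne', one_mul] at h2
    have hbad : |∑ p ∈ Bad, F p| ≤ N * (e / 2) := by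
      calc |∑ p ∈ Bad, F p| ≤ ∑ p ∈ Bad, |F p| := Finset.abs_sum_le_sum_abs _ _
        _ ≤ ∑ _p ∈ Bad, Ku := Finset.sum_le_sum fun p _ => hF p
        _ = Bad.card * Ku := by rw [Finset.sum_const, nsmul_eq_mul]
        _ ≤ N * (e / 2) := htail
    have hgood : N * (Γ - e) ≤ ∑ p ∈ Badᶜ, F p := by
      have hsplit := Finset.sum_add_sum_compl Bad F
      have := (abs_le.1 hbad).2
      linarith
    have hcard : ((Badᶜ).card : ℝ) ≤ N := by
      rw [← hN]
      exact_mod_cast Finset.card_le_univ _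
    have hconst : ∑ _p ∈ Badᶜ, (Γ - e) ≤ ∑ p ∈ Badᶜ, F p := by
      rw [Finset.sum_const, nsmul_eq_mul]
      exact le_trans (mul_le_mul_of_nonneg_right hcard hpos) hgood
    obtain ⟨p, hp, hle⟩ := Finset.exists_le_of_sum_le hne hconst
    exact ⟨p, Finset.mem_compl.1 hp, hle.trans (le_abs_self _)⟩

/-! ## The registered tools stub -/

/-- **Tools stub `stub_tautLoopWalk6AAux`** (registered; pure auxiliary lemmas, part 1, for the
assembly of skeleton stub 6A `stub_tautLoopWalkSelection`): threshold extraction and eventual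
smallness facts at `0⁺`, circulations modulo gradients, displacements along deformed orbits,
lengths of images of loops, the exponential length algebra, the `o(h)` bookkeeping, the tail
arithmetic and the first-moment selection. [folklore] -/
theorem stub_tautLoopWalk6AAux : (∀ (P : ℝ → Prop), (∀ᶠ h in nhdsWithin (0:ℝ) (Set.Ioi 0), P h) → ∃ h₀ : ℝ, 0 < h₀ ∧ ∀ h : ℝ, 0 < h → h < h₀ → P h) ∧ (∀ (c : ℝ), 0 < c → ∀ᶠ h in nhdsWithin (0:ℝ) (Set.Ioi 0), h < c) ∧ (∀ (a b c : ℝ), 0 < c → ∀ᶠ h in nhdsWithin (0:ℝ) (Set.Ioi 0), a * h + b * h ^ (1 / 3 : ℝ) ≤ c) ∧ (∀ (c C : ℝ) (m : ℕ), 0 < c → ∀ᶠ h in nhdsWithin (0:ℝ) (Set.Ioi 0), C * Real.exp (-(1 / (c * h ^ (1 / 3 : ℝ)))) ≤ (h ^ (1 / 3 : ℝ)) ^ m) ∧ (∀ (f g : EuclideanSpace ℝ (Fin 3) → EuclideanSpace ℝ (Fin 3)) (Q : EuclideanSpace ℝ (Fin 3) → ℝ) (γ : ℝ → EuclideanSpace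 ℝ (Fin 3)) (ε : ℝ), Continuous f → Continuous g → Differentiable ℝ Q → Literature.Analysis.FluidPDE.IsC1Loop γ → (∀ x, ‖f x - g x - gradient Q x‖ ≤ ε) → |Literature.Analysis.FluidPDE.circulation f γ - Literature.Analysis.FluidPDE.circulation g γ| ≤ ε * ∫ σ in (0:ℝ)..1, ‖deriv γ σ‖) ∧ (∀ (n : ℕ) (A Ψ : ℕ → EuclideanSpace ℝ (Fin 3) → EuclideanSpace ℝ (Fin 3)) (yv S : ℕ → EuclideanSpace ℝ (Fin 3)) (D : ℝ) (x : EuclideanSpace ℝ (Fin 3)), (∀ k, k < n → ∀ y, ‖A k y - y‖ ≤ D) → S 0 = 0 → (∀ k, k < n → S (k + 1) = S k + yv k) → Ψ n x = x → (∀ k, k < n → Ψ k x = A k (Ψ (k + 1) x) + yv k) → ∀ k, k ≤ n → ‖Ψ k x - x - (S n - S k)‖ ≤ (n - k) * D) ∧ (∀ (Ψ : EuclideanSpace ℝ (Fin 3) → EuclideanSpace ℝ (Fin 3)) (γ : ℝ → EuclideanSpace ℝ (Fin 3)) (C : ℝ), ContDiff ℝ 1 Ψ → Literature.Analysis.FluidPDE.IsC1Loop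 γ → (∀ x, ‖fderiv ℝ Ψ x‖ ≤ C) → (∫ σ in (0:ℝ)..1, ‖deriv (Ψ ∘ γ) σ‖) ≤ C * ∫ σ in (0:ℝ)..1, ‖deriv γ σ‖) ∧ (∀ (ℓ ℓ' N h ε β δ : ℝ), 0 ≤ ℓ → |N| ≤ β * ℓ → ℓ' ≤ ℓ + h * N + (ε + h ^ 2 * β ^ 2) * ℓ → ε + h ^ 2 * β ^ 2 ≤ h * δ → ℓ' ≤ ℓ * Real.exp (h * (N / ℓ + δ))) ∧ (∀ (n : ℕ) (τ h K B₁ B₂ Bt lam δ : ℝ), (n : ℝ) * τ = h → 0 ≤ h → h ≤ 1 → 0 ≤ τ → τ ≤ h → 0 ≤ K → 0 ≤ B₁ → (Real.exp (B₁ + K) * ((B₁ + K) ^ 2 + K) + B₂ * K + Bt + B₁ ^ 2) * h + 2 * B₂ * lam ≤ δ → Real.exp (n * (τ * B₁ + K * τ ^ 2)) * ((n * (τ * B₁ + K * τ ^ 2)) ^ 2 + n * (K * τ ^ 2)) + n * τ * (B₂ * (n * (K * τ) + 2 * lam) + Bt * h) + h ^ 2 * B₁ ^ 2 ≤ h * δ)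 ∧ (∀ (ν h lam a Ku cnt : ℝ) (n M : ℕ), 0 < ν → 0 < n → 0 < lam → lam ^ 3 = h → a ^ 2 = 6 * ν * (h / n) → 0 ≤ Ku → cnt ≤ 12 * (6:ℝ) ^ n * Real.exp (-(lam ^ 2) / (6 * n * a ^ 2)) → 24 * Ku * Real.exp (-(1 / (36 * ν * lam))) ≤ lam ^ (3 * M) → 13 * Real.exp (-(1 / (36 * ν * lam))) ≤ lam ^ 0 → cnt * Ku ≤ (6:ℝ) ^ n * (h ^ M / 2) ∧ cnt < (6:ℝ) ^ n) ∧ (∀ (n : ℕ) (Bad : Finset (Fin n → Fin 6)) (F : (Fin n → Fin 6) → ℝ) (Γ Ku e N : ℝ), (Fintype.card (Fin n → Fin 6) : ℝ) = N → 0 < N → |N⁻¹ * (∑ p, F p) - Γ| ≤ e / 2 → (∀ p, |F p| ≤ Ku) → (Bad.card : ℝ) * Ku ≤ N * (e / 2) → (Bad.card : ℝ) < N → ∃ p, p ∉ Bad ∧ Γ - e ≤ |F p|) :=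
  ⟨tautLoopWalk6A_exists_h0, tautLoopWalk6A_eventually_lt, tautLoopWalk6A_eventually_affine,
    tautLoopWalk6A_eventually_tail, tautLoopWalk6A_circulation_sub_le, tautLoopWalk6A_disp_partial,
    tautLoopWalk6A_len_comp_le, tautLoopWalk6A_len_algebra, tautLoopWalk6A_eps_arith,
    tautLoopWalk6A_tail_arith, fun _ Bad F Γ Ku e N => tautLoopWalk6A_select Bad F Γ Ku e N⟩

end Summit.NavierStokesRegularity.NavierStokesRegularity.Theorems

end
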